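/-
Copyright (c) 2026 the pub-hodgecm-mathlib formalisation cell (harness21).  Prover seat hodgecm-mathlib-K2E4-p21 (g2), Track B «K2-LIT» ∕ h413,
line (ii′) «H-side central germ expansion» (lead K2E4-p06 (g2)), letter (S′♮) «EP witness on `H_v` with negative central value + stable rider».  2026-09-04.
-/
import Summits.HodgeConjecture.HodgeConjecture.Theorems.K2E3CentralGermEPWitness       -- ★ p855829 (this seat): (S′) `centralGermEPWitness` at every non-split `v`
import HarnessLib

/-!
# K2 · E3 · line (ii′) — (S′♮) THE EULER–POINCARÉ WITNESS ON `H_v` WITH ITS STABLE RIDER `Φ^st(γ, f₀) = κ · NST(γ)`, every non-split `v`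
# [Kottwitz1988 §2 Thm. 2; Rogawski1990 §12.6 p. 174, §3.5 Prop. 3.5.2 (c) p. 29, §4.1 (4.1.1) p. 39]

Cell `pub/hodgecm-mathlib` (D-0151), crux H413 = `stmt-HodgeConjecture-24833` (lane `--supports … --as helper`), route HCCMUnconditional; Track B «K2-LIT»,
E3 module `Cruxes/H413/Lines/K2_E3_EllipticInputsSigs_U3bCentralGerms.lean`, line (ii′) (lead K2E4-p06 (g2) RULING 23:44:49Z: new leaf (S′♮) `sig_K2E3CentralGermEPWitnessStable`
= (S′) + stable rider); seat K2E4-p21 (g2).  THEOREMS ONLY (no definition, no instance, no notation, no named fact, no `sorry`); ★-only imports.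

THE RIDER.  `NST γ := ({c : ConjClasses H_v | IsLocalStablyConjH L v γ (out c)}.ncard : ℂ)` — the number of `H_v`-conjugacy classes in the stable class of `γ`
(`= |𝒟_H(T∕F)| ∈ {1, 2}` by torus type, [Rogawski1990] Prop. 3.5.2 (c); the ★ currency of `RankOneEulerPoincareNonsplit.exists_stableOrbitalIntegralRel_eq_ncard`).
`Φ^st(γ, f) = ∑ᶠ_{c : st γ (out c)} Φ(c, f)` (★ `stableOrbitalIntegralRel`); every class of the stable class of an elliptic `G`-regular `γ` is again `G`-regular
(★ `isLocalGRegular_of_isLocalStablyConjH`) with compact centraliser (★ `compactSpace_centralizer_fst_iff_of_isLocalStablyConjH`, ★ `compactSpace_centralizerH_of_fst`), so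
★ (S′) gives the SAME value `κ` at each of them and the finsum is `κ · NST(γ)` — with NO finiteness input: if the class set were infinite both sides vanish
(`finsum` junk `0`, `Set.ncard = 0`).

* `centralGermEPWitnessStable` : ‹(S′♮) `sig_K2E3CentralGermEPWitnessStable`› (cand `K2/K2E4-p21/g2/…Stable.cand…`, U3b prefix VERBATIM) at EVERY non-split `v`.
HONEST LABEL: count-neutral helper until the dealer hosts (S′♮); HC_CM is proved only modulo the 7 printed citations (2 remaining named inputs: hLiu418 =
`stmt-HodgeConjecture-24832`, h413 = `stmt-HodgeConjecture-24833`) until rung 0 closes.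

## References
* [Kottwitz1988] R. E. Kottwitz, *Tamagawa numbers*, Ann. of Math. 127 (1988), §2 Theorem 2.
* [Rogawski1990] J. D. Rogawski, *Automorphic Representations of Unitary Groups in Three Variables*, Ann. of Math. Stud. 123 (1990): §3.5 Prop. 3.5.2 (c) p. 29, §4.1 (4.1.1) p. 39,
  §12.6 p. 174.
-/

set_option autoImplicit false
-- the mandated namespace has the single-problem summit's repeated segment (`HodgeConjecture.HodgeConjecture`)
set_option linter.dupNamespace false

noncomputable section

open Filter Topology
open MeasureTheory Measure NumberField IsDedekindDomain
open Literature.MeasureTheory.Group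
open Literature.NumberTheory.Rogawski1990 Literature.NumberTheory.Automorphic
open Literature.AlgebraicGeometry.ShimuraVarieties (unitaryGroup hermForm)
open scoped Matrix MatrixGroups

namespace Summit.HodgeConjecture.HodgeConjecture.Cruxes.H413.K2E3CentralGermEPWitnessStable

set_option maxHeartbeats 800000 in
set_option synthInstance.maxHeartbeats 200000 in
-- HB: the U3b prefix (33 binders, two carriers) is elaborated in one declaration
/-- **(S′♮) THE EULER–POINCARÉ WITNESS ON `H_v` WITH NEGATIVE CENTRAL VALUE AND ITS STABLE RIDER** — pays `U3bCentralGerms.sig_K2E3CentralGermEPWitnessStable` (bytes VERBATIM)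
at EVERY non-split `v`: for every central `z ∈ H_v` there are `f₀ ∈ C_c^∞(H_v)`, `r, κ > 0` with `f₀ z = −r`, `Φ(⟦γ⟧, f₀; mHv) = κ` at every elliptic `G`-regular class,
AND `Φ^st(γ, f₀; mHv) = κ · NST(γ)` at every elliptic `G`-regular `γ` (`NST γ` = number of classes in the stable class).  ★ (S′) `centralGermEPWitness` + one `finsum`.
[cite: Kottwitz1988, §2 Theorem 2] [cite: Rogawski1990, §12.6 p. 174; §4.1 (4.1.1) p. 39; §3.5 Prop. 3.5.2 (c) p. 29] -/
theorem centralGermEPWitnessStable :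
    ∀ (L : Type) [Field L] [NumberField L] [IsCMField L] (H' : Matrix (Fin 3) (Fin 3) L),
      (H'.map (cmConjRingHom L)).transpose = H' →
      (∀ x : Fin 3 → L, hermForm (cmConjRingHom L) H' x x = 0 → x = 0) →
    ∀ (v : HeightOneSpectrum (𝓞 ↥(maximalRealSubfield L)))
      [MeasurableSpace ((UnitaryGroup.cmDatum L 2 (Matrix.of fun i j : Fin 2 => if i.val + j.val + 1 = 2 then (1 : L) else 0)).Local v × (UnitaryGroup.cmDatum L 1 (Matrix.of fun i j : Fin 1 => if i.val + j.val + 1 = 1 then (1 : L) else 0)).Local v)] [BorelSpace ((UnitaryGroup.cmDatum L 2 (Matrix.of fun i j : Fin 2 => if i.val + j.val + 1 = 2 then (1 : L) else 0)).Local v × (UnitaryGroup.cmDatum L 1 (Matrix.of fun i j : Fin 1 => if i.val + j.val + 1 = 1 then (1 : L) else 0)).Local v)]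
      [∀ a : (UnitaryGroup.cmDatum L 2 (Matrix.of fun i j : Fin 2 => if i.val + j.val + 1 = 2 then (1 : L) else 0)).Local v × (UnitaryGroup.cmDatum L 1 (Matrix.of fun i j : Fin 1 => if i.val + j.val + 1 = 1 then (1 : L) else 0)).Local v,
        MeasurableSpace (((UnitaryGroup.cmDatum L 2 (Matrix.of fun i j : Fin 2 => if i.val + j.val + 1 = 2 then (1 : L) else 0)).Local v × (UnitaryGroup.cmDatum L 1 (Matrix.of fun i j : Fin 1 => if i.val + j.val + 1 = 1 then (1 : L) else 0)).Local v) ⧸ Subgroup.centralizer ({a} : Set ((UnitaryGroup.cmDatum L 2 (Matrix.of fun i j : Fin 2 => if i.val + j.val + 1 = 2 then (1 : L) else 0)).Local v × (UnitaryGroup.cmDatum L 1 (Matrix.of fun i j : Fin 1 => if i.val + j.val + 1 = 1 then (1 : L) else 0)).Local v)))]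
      [∀ a : (UnitaryGroup.cmDatum L 2 (Matrix.of fun i j : Fin 2 => if i.val + j.val + 1 = 2 then (1 : L) else 0)).Local v × (UnitaryGroup.cmDatum L 1 (Matrix.of fun i j : Fin 1 => if i.val + j.val + 1 = 1 then (1 : L) else 0)).Local v,
        BorelSpace (((UnitaryGroup.cmDatum L 2 (Matrix.of fun i j : Fin 2 => if i.val + j.val + 1 = 2 then (1 : L) else 0)).Local v × (UnitaryGroup.cmDatum L 1 (Matrix.of fun i j : Fin 1 => if i.val + j.val + 1 = 1 then (1 : L) else 0)).Local v) ⧸ Subgroup.centralizer ({a} : Set ((UnitaryGroup.cmDatum L 2 (Matrix.of fun i j : Fin 2 => if i.val + j.val + 1 = 2 then (1 : L) else 0)).Local v × (UnitaryGroup.cmDatum L 1 (Matrix.of fun i j : Fin 1 => if i.val + j.val + 1 = 1 then (1 : L) else 0)).Local v)))]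
      [MeasurableSpace ((UnitaryGroup.cmDatum L 3 H').Local v)] [BorelSpace ((UnitaryGroup.cmDatum L 3 H').Local v)]
      [∀ γ : (UnitaryGroup.cmDatum L 3 H').Local v, MeasurableSpace ((UnitaryGroup.cmDatum L 3 H').Local v ⧸ Subgroup.centralizer ({γ} : Set ((UnitaryGroup.cmDatum L 3 H').Local v)))]
      [∀ γ : (UnitaryGroup.cmDatum L 3 H').Local v, BorelSpace ((UnitaryGroup.cmDatum L 3 H').Local v ⧸ Subgroup.centralizer ({γ} : Set ((UnitaryGroup.cmDatum L 3 H').Local v)))]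
      (νHv : Measure ((UnitaryGroup.cmDatum L 2 (Matrix.of fun i j : Fin 2 => if i.val + j.val + 1 = 2 then (1 : L) else 0)).Local v × (UnitaryGroup.cmDatum L 1 (Matrix.of fun i j : Fin 1 => if i.val + j.val + 1 = 1 then (1 : L) else 0)).Local v)) (νGv : Measure ((UnitaryGroup.cmDatum L 3 H').Local v))
      [IsFiniteMeasureOnCompacts νHv] [νHv.IsMulRightInvariant] [νGv.IsHaarMeasure] [νGv.IsMulRightInvariant]
      (Δv : LocalTransferFactor L H' v)
      (mHv : OrbitalMeasureFamily ((UnitaryGroup.cmDatum L 2 (Matrix.of fun i j : Fin 2 => if i.val + j.val + 1 = 2 then (1 : L) else 0)).Local v × (UnitaryGroup.cmDatum L 1 (Matrix.of fun i j : Fin 1 => if i.val + j.val + 1 = 1 then (1 : L) else 0)).Local v)) (mGv : OrbitalMeasureFamily ((UnitaryGroup.cmDatum L 3 H').Local v)),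
      IsLocalTransferDatum L H' v Δv mHv mGv →
      mHv.IsCanonical (IsLocalGRegular L v) νHv →
      mGv.IsCanonical (fun γ : (UnitaryGroup.cmDatum L 3 H').Local v => IsRegularElt (γ.val : GL (Fin 3) (UnitaryGroup.LocalRing L v))) νGv →
      Subsingleton (UnitaryGroup.PlacesOver L v) →
    ∀ z : (UnitaryGroup.cmDatum L 2 (Matrix.of fun i j : Fin 2 => if i.val + j.val + 1 = 2 then (1 : L) else 0)).Local v × (UnitaryGroup.cmDatum L 1 (Matrix.of fun i j : Fin 1 => if i.val + j.val + 1 = 1 then (1 : L) else 0)).Local v, z ∈ Subgroup.center ((UnitaryGroup.cmDatum L 2 (Matrix.of fun i j : Fin 2 => if i.val + j.val + 1 = 2 then (1 : L) else 0)).Local v × (UnitaryGroup.cmDatum L 1 (Matrix.of fun i j : Fin 1 => if i.val + j.val + 1 = 1 then (1 : L) else 0)).Local v) →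
    ∃ (f₀ : (UnitaryGroup.cmDatum L 2 (Matrix.of fun i j : Fin 2 => if i.val + j.val + 1 = 2 then (1 : L) else 0)).Local v × (UnitaryGroup.cmDatum L 1 (Matrix.of fun i j : Fin 1 => if i.val + j.val + 1 = 1 then (1 : L) else 0)).Local v → ℂ) (r κ : ℝ), IsLocSmooth f₀ ∧ 0 < r ∧ f₀ z = -(r : ℂ) ∧ 0 < κ ∧
      (∀ γ : (UnitaryGroup.cmDatum L 2 (Matrix.of fun i j : Fin 2 => if i.val + j.val + 1 = 2 then (1 : L) else 0)).Local v × (UnitaryGroup.cmDatum L 1 (Matrix.of fun i j : Fin 1 => if i.val + j.val + 1 = 1 then (1 : L) else 0)).Local v, IsLocalGRegular L v γ →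
        CompactSpace (Subgroup.centralizer ({γ} : Set ((UnitaryGroup.cmDatum L 2 (Matrix.of fun i j : Fin 2 => if i.val + j.val + 1 = 2 then (1 : L) else 0)).Local v × (UnitaryGroup.cmDatum L 1 (Matrix.of fun i j : Fin 1 => if i.val + j.val + 1 = 1 then (1 : L) else 0)).Local v))) →
        classOrbitalIntegral mHv f₀ (ConjClasses.mk γ) = (κ : ℂ)) ∧
      (∀ γ : (UnitaryGroup.cmDatum L 2 (Matrix.of fun i j : Fin 2 => if i.val + j.val + 1 = 2 then (1 : L) else 0)).Local v × (UnitaryGroup.cmDatum L 1 (Matrix.of fun i j : Fin 1 => if i.val + j.val + 1 = 1 then (1 : L) else 0)).Local v, IsLocalGRegular L v γ →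
        CompactSpace (Subgroup.centralizer ({γ} : Set ((UnitaryGroup.cmDatum L 2 (Matrix.of fun i j : Fin 2 => if i.val + j.val + 1 = 2 then (1 : L) else 0)).Local v × (UnitaryGroup.cmDatum L 1 (Matrix.of fun i j : Fin 1 => if i.val + j.val + 1 = 1 then (1 : L) else 0)).Local v))) →
        stableOrbitalIntegralRel (IsLocalStablyConjH L v) mHv f₀ γ =
          (κ : ℂ) * (({c : ConjClasses ((UnitaryGroup.cmDatum L 2 (Matrix.of fun i j : Fin 2 => if i.val + j.val + 1 = 2 then (1 : L) else 0)).Local v × (UnitaryGroup.cmDatum L 1 (Matrix.of fun i j : Fin 1 => if i.val + j.val + 1 = 1 then (1 : L) else 0)).Local v) | IsLocalStablyConjH L v γ (Quotient.out c)}).ncard : ℂ)) := by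
  intro L _ _ _ H' hherm hanis v _ _ _ _ _ _ _ _ νHv νGv _ _ _ _ Δv mHv mGv hLTD hcanH hcanG hsub z hz
  classical
  have hns : ∀ w' : UnitaryGroup.PlacesOver L v, IsCMField.complexConj L • w'.1 = w'.1 := fun w' => smul_eq_of_subsingleton_placesOver L hsub w'
  obtain ⟨f₀, r, κ, hf₀, hr, hval, hκ, hcls⟩ :=
    K2E3CentralGermEPWitness.centralGermEPWitness L H' hherm hanis v νHv νGv Δv mHv mGv hLTD hcanH hcanG hsub z hz
  refine ⟨f₀, r, κ, hf₀, hr, hval, hκ, hcls, fun γ hγ hZ => ?_⟩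
  haveI := hZ
  haveI := F0P3cStCharTSEllMassHOrbEll.compactSpace_centralizer_fst_of_centralizerH L v γ
  -- every class of the stable class of `γ` is an elliptic `G`-regular class, where `Φ(·, f₀) = κ`
  have hconst : ∀ c ∈ {c : ConjClasses ((UnitaryGroup.cmDatum L 2 (Matrix.of fun i j : Fin 2 => if i.val + j.val + 1 = 2 then (1 : L) else 0)).Local v × (UnitaryGroup.cmDatum L 1 (Matrix.of fun i j : Fin 1 => if i.val + j.val + 1 = 1 then (1 : L) else 0)).Local v) | IsLocalStablyConjH L v γ (Quotient.out c)},
      classOrbitalIntegral mHv f₀ c = (κ : ℂ) := by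
    intro c hc
    have hreg' : IsLocalGRegular L v (Quotient.out c) := isLocalGRegular_of_isLocalStablyConjH L v hc hγ
    haveI : CompactSpace (Subgroup.centralizer ({(Quotient.out c : (UnitaryGroup.cmDatum L 2 (Matrix.of fun i j : Fin 2 => if i.val + j.val + 1 = 2 then (1 : L) else 0)).Local v × (UnitaryGroup.cmDatum L 1 (Matrix.of fun i j : Fin 1 => if i.val + j.val + 1 = 1 then (1 : L) else 0)).Local v).1} : Set ((UnitaryGroup.cmDatum L 2 (Matrix.of fun i j : Fin 2 => if i.val + j.val + 1 = 2 then (1 : L) else 0)).Local v))) :=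
      (compactSpace_centralizer_fst_iff_of_isLocalStablyConjH L v hγ hc).1 inferInstance
    haveI := F0P3cStCharTSEllMassHOrbEll.compactSpace_centralizerH_of_fst L v hns (Quotient.out c)
    have h := hcls (Quotient.out c) hreg' inferInstance
    rwa [← ConjClasses.quotient_mk_eq_mk, Quotient.out_eq] at h
  rw [stableOrbitalIntegralRel_def]
  by_cases hfin : ({c : ConjClasses ((UnitaryGroup.cmDatum L 2 (Matrix.of fun i j : Fin 2 => if i.val + j.val + 1 = 2 then (1 : L) else 0)).Local v × (UnitaryGroup.cmDatum L 1 (Matrix.of fun i j : Fin 1 => if i.val + j.val + 1 = 1 then (1 : L) else 0)).Local v) | IsLocalStablyConjH L v γ (Quotient.out c)}).Finite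
  · rw [finsum_mem_eq_finite_toFinset_sum _ hfin, Finset.sum_congr rfl (fun c hc => hconst c (hfin.mem_toFinset.1 hc)), Finset.sum_const, nsmul_eq_mul,
      Set.ncard_eq_toFinset_card _ hfin, mul_comm]
  · have hκ0 : (κ : ℂ) ≠ 0 := Complex.ofReal_ne_zero.2 hκ.ne'
    have hinf : ({c : ConjClasses ((UnitaryGroup.cmDatum L 2 (Matrix.of fun i j : Fin 2 => if i.val + j.val + 1 = 2 then (1 : L) else 0)).Local v × (UnitaryGroup.cmDatum L 1 (Matrix.of fun i j : Fin 1 => if i.val + j.val + 1 = 1 then (1 : L) else 0)).Local v) | IsLocalStablyConjH L v γ (Quotient.out c)} ∩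
        Function.support fun c => classOrbitalIntegral mHv f₀ c).Infinite :=
      Set.Infinite.mono (fun c hc => ⟨hc, by rw [Function.mem_support, hconst c hc]; exact hκ0⟩) hfin
    rw [finsum_mem_eq_zero_of_infinite hinf, Set.Infinite.ncard hfin, Nat.cast_zero, mul_zero]

end Summit.HodgeConjecture.HodgeConjecture.Cruxes.H413.K2E3CentralGermEPWitnessStable

end
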